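import Summits.ABC.ABC.Theses.RibetTakahashiSplit
import Summits.ABC.ABC.Theorems.RibetTakahashiSplitFewPrimeValuationProductSwitchingPosition
import Literature.NumberTheory.Automorphic.ShimuraCurve
import Literature.NumberTheory.EllipticCurves.ValuationProductOfSzpiroProofs

/-!
# Line `switching-triangle` for crux `FewPrimeValuationProduct` (stmt-ABC-1563): calibration of the lever

Helpers (`--supports stmt-ABC-1563`, lead c2). The line's ONE open load-bearing analytic stub is the
LEVER `stub_twoPrimeMeanSquareLowerBound` — "Jacquet–Langlands preserves the size of integral newforms"
at the two-prime levels `(pq, N/pq)`: for every `ε > 0` there is `C` such that for every elliptic `W/ℚ`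
semistable away from `2`, every two distinct multiplicative primes `p, q`, every Néron period pair `L`,
every Shimura-curve datum `X` of level `(pq, N/(pq))`, every fundamental domain `F` of finite positive
volume and every non-zero weight-two form `s` on `X.Gamma` with periods in `Λ_L`,
`log((vol F)⁻¹ ∫_F ‖s‖² y²) ≥ −(ε log N + C)`.

This file records, kernel-checked over the landed vocabulary and with NO modular input proved or
assumed beyond explicit hypotheses, that the lever carries no strength of its own:

* `twoPrimeMeanSquareLowerBound_of_lowerPackage_of_pairBound` — the lever FOLLOWS from (a) the LOWER
  half of the two-prime package, `log vol F − log ∫_F ‖s‖² y² ≤ C + ε log N + log(c_p c_q)` for every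
  admissible `(L, X, F, s)` (in print: `∫‖s‖² = deg φ_s · covol Λ_L ≥ δ_{pq,M} covol Λ_E`, the
  Ribet–Takahashi numerator direction `δ_{1,N} ≤ K c_p c_q δ_{pq,M}` (Pasten arXiv:1705.09251 Thm 6.1 /
  Prop 6.13 with Mazur–Kenku), Frey–Zagier `δ_{1,N} covol = 4π² c² ‖f‖²`, the GHL lower bound
  `‖f‖² ≫ N^{1−ε}` and the Shimizu volume `vol ≪ N^{1+ε}` — posited here as a hypothesis SHAPE, exactly
  as the upper half is the shape of `stub_twoPrimePackage`), and (b) the PAIR BOUND `c_p c_q ≤ C N^ε`;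
* `twoPrime_pairBound_of_manyPrime_of_fewPrime`, `twoPrime_pairBound_of_szpiro` — the pair bound is
  the two valuation-product cruxes r2 ∧ r4 read on pairs (`c_p c_q ≤ T(W)`), and follows from Szpiro
  (`multiplicativeValuationProduct_le_of_szpiro_all`);
* hence `twoPrimeMeanSquareLowerBound_of_lowerPackage_of_manyPrime_of_fewPrime` and
  `twoPrimeMeanSquareLowerBound_of_lowerPackage_of_szpiro`: modulo the two-sided package the lever is
  EQUIVALENT to the pair half of the valuation-product conjecture (sufficiency: `pairwiseGcdBound_of_parts`,
  p143114; necessity: this file + `pairwiseGcdBound_hcard_of_fewPrimeValuationProduct`, p144159), and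
  it is sandwiched under Szpiro like the crux itself (Disproof §3). Same position as the sibling crux's
  dead lever (`Cruxes/ManyPrimeValuationProduct/Lines/jl-zero-cycle-height-dead.md`, p117706/p122590).

No definitions; theorems only; the lever's statement appears verbatim as registered.
-/

-- `Summit.<Summit>.<Problem>` is the mandated summit-side namespace (CONVENTIONS §2); for the
-- single-conjunct summit `ABC` the two coincide, so the duplicate `ABC.ABC` is deliberate.
set_option linter.dupNamespace false

noncomputable section

open MeasureTheory

namespace Summit.ABC.ABC.Theorems.FewPrimeValuationProduct

open Summit.ABC.ABC.Theses.RibetTakahashiSplit (FewPrimeValuationProduct ManyPrimeValuationProduct)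
open Literature.NumberTheory.EllipticCurves (SzpiroConjecture multiplicativeValuationProduct_le_of_szpiro_all)
open Literature.NumberTheory.DiophantineGeometry (multiplicativeValuationProduct)

/-- **The pair bound from the two valuation-product cruxes.** For every elliptic `W` semistable
away from `2` and distinct multiplicative `p ≠ q`: `c_p c_q ≤ T(W) ≤ C N^ε`, by r2 (`≥ 4` odd
multiplicative primes) or r4 (`≤ 3`). [folklore] -/
theorem twoPrime_pairBound_of_manyPrime_of_fewPrime : Summit.ABC.ABC.Theses.RibetTakahashiSplit.ManyPrimeValuationProduct → Summit.ABC.ABC.Theses.RibetTakahashiSplit.FewPrimeValuationProduct → ∀ ε : ℝ, 0 < ε → ∃ C : ℝ, ∀ (W : WeierstrassCurve ℚ) [W.IsElliptic], (∀ p : ℕ, p.Prime → p ≠ 2 → ¬ p ^ 2 ∣ W.conductorNorm ℤ) → ∀ p ∈ (W.conductorNorm ℤ).primeFactors.filter (fun p => ¬ p ^ 2 ∣ W.conductorNorm ℤ), ∀ q ∈ (W.conductorNorm ℤ).primeFactors.filter (fun p => ¬ p ^ 2 ∣ W.conductorNorm ℤ), p ≠ q → (((W.minimalDiscriminantNorm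 ℤ).factorization p * (W.minimalDiscriminantNorm ℤ).factorization q : ℕ) : ℝ) ≤ C * (W.conductorNorm ℤ : ℝ) ^ ε := by
  intro h2 h4 ε hε
  obtain ⟨C₂, hC₂⟩ := h2 ε hε
  obtain ⟨C₄, hC₄⟩ := h4 ε hε
  refine ⟨max C₂ C₄, fun W _ hss p hp q hq hpq => ?_⟩
  set S := (W.conductorNorm ℤ).primeFactors.filter (fun p => ¬ p ^ 2 ∣ W.conductorNorm ℤ) with hS
  set c : ℕ → ℕ := fun r => (W.minimalDiscriminantNorm ℤ).factorization r with hc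
  have hN0 : (0 : ℝ) ≤ (W.conductorNorm ℤ : ℝ) := Nat.cast_nonneg _
  have hNε : 0 ≤ (W.conductorNorm ℤ : ℝ) ^ ε := Real.rpow_nonneg hN0 ε
  have hone : ∀ r ∈ S, 1 ≤ c r := fun r hr =>
    ManyPrimeValuationProduct.one_le_factorization_of_mem_filter W hr
  have hmul : ((c p * c q : ℕ) : ℝ) ≤ ((∏ r ∈ S, c r : ℕ) : ℝ) := by
    exact_mod_cast position_mul_le_prod hone hp hq hpq
  rcases le_or_gt 4 (((W.conductorNorm ℤ).primeFactors.filter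
      (fun p => p ≠ 2 ∧ ¬ p ^ 2 ∣ W.conductorNorm ℤ)).card) with h4le | hlt
  · have hT := hC₂ W hss h4le
    exact hmul.trans (hT.trans (mul_le_mul_of_nonneg_right (le_max_left _ _) hNε))
  · have hT := hC₄ W hss (by omega)
    exact hmul.trans (hT.trans (mul_le_mul_of_nonneg_right (le_max_right _ _) hNε))

/-- **The pair bound from Szpiro's conjecture** (`multiplicativeValuationProduct_le_of_szpiro_all`:
`T(W) ≤ K N^ε` for every elliptic curve; `c_p c_q ≤ T(W)`). [folklore] -/
theorem twoPrime_pairBound_of_szpiro : Literature.NumberTheory.EllipticCurves.SzpiroConjecture → ∀ ε : ℝ, 0 < ε → ∃ C : ℝ, ∀ (W : WeierstrassCurve ℚ) [W.IsElliptic], (∀ p : ℕ, p.Prime → p ≠ 2 → ¬ p ^ 2 ∣ W.conductorNorm ℤ) → ∀ p ∈ (W.conductorNorm ℤ).primeFactors.filter (fun p => ¬ p ^ 2 ∣ W.conductorNorm ℤ), ∀ q ∈ (W.conductorNorm ℤ).primeFactors.filter (fun p => ¬ p ^ 2 ∣ W.conductorNorm ℤ), p ≠ q → (((W.minimalDiscriminantNorm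 ℤ).factorization p * (W.minimalDiscriminantNorm ℤ).factorization q : ℕ) : ℝ) ≤ C * (W.conductorNorm ℤ : ℝ) ^ ε := by
  intro hS ε hε
  obtain ⟨K, hK⟩ := multiplicativeValuationProduct_le_of_szpiro_all hS hε
  refine ⟨K, fun W _ _ p hp q hq hpq => ?_⟩
  set S := (W.conductorNorm ℤ).primeFactors.filter (fun p => ¬ p ^ 2 ∣ W.conductorNorm ℤ) with hS
  set c : ℕ → ℕ := fun r => (W.minimalDiscriminantNorm ℤ).factorization r with hc
  have hone : ∀ r ∈ S, 1 ≤ c r := fun r hr =>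
    ManyPrimeValuationProduct.one_le_factorization_of_mem_filter W hr
  have hmul : ((c p * c q : ℕ) : ℝ) ≤ ((∏ r ∈ S, c r : ℕ) : ℝ) := by
    exact_mod_cast position_mul_le_prod hone hp hq hpq
  have hT : ((∏ r ∈ S, c r : ℕ) : ℝ) ≤ K * (W.conductorNorm ℤ : ℝ) ^ ε := hK W
  exact hmul.trans hT

/-- **The lever from the LOWER package and the pair bound** (registered sub-goal; conclusion = the
registered lever `stub_twoPrimeMeanSquareLowerBound` verbatim). With `ε/2` twice:
`log V − log I ≤ C₁ + (ε/2) log N + log(c_p c_q)` and `log(c_p c_q) ≤ log C₂ + (ε/2) log N` give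
`−(ε log N + C) ≤ log(V⁻¹ I)` with `C = C₁ + max (log C₂) 0`. [folklore] -/
theorem twoPrimeMeanSquareLowerBound_of_lowerPackage_of_pairBound : (∀ ε : ℝ, 0 < ε → ∃ C : ℝ, ∀ (W : WeierstrassCurve ℚ) [W.IsElliptic], (∀ p : ℕ, p.Prime → p ≠ 2 → ¬ p ^ 2 ∣ W.conductorNorm ℤ) → ∀ p ∈ (W.conductorNorm ℤ).primeFactors.filter (fun p => ¬ p ^ 2 ∣ W.conductorNorm ℤ), ∀ q ∈ (W.conductorNorm ℤ).primeFactors.filter (fun p => ¬ p ^ 2 ∣ W.conductorNorm ℤ), p ≠ q → ∀ (L : PeriodPair), (∃ C' : WeierstrassCurve.VariableChange ℚ, (C' • W).IsGloballyMinimal ∧ Literature.NumberTheory.EllipticCurves.ModularForms.IsNeronLatticeOf ((C' • W).baseChange ℂ) L) → ∀ (X : Literature.NumberTheory.Automorphic.ShimuraCurveData (p * q) (W.conductorNorm ℤ / (p * q))) (F : Set UpperHalfPlane), Literature.NumberTheory.Automorphic.IsHypFundamentalDomain X.Gamma F → MeasureTheory.volume F ≠ 0 → MeasureTheory.volume F ≠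 ⊤ → ∀ (s : CuspForm X.Gamma 2), s ≠ 0 → Literature.NumberTheory.Automorphic.HasPeriodsIn X.Gamma s (L.lattice : Set ℂ) → MeasureTheory.IntegrableOn (fun z => ‖s z‖ ^ 2 * z.im ^ 2) F → (0 < ∫ z in F, ‖s z‖ ^ 2 * z.im ^ 2) → Real.log (MeasureTheory.volume F).toReal - Real.log (∫ z in F, ‖s z‖ ^ 2 * z.im ^ 2) ≤ C + ε * Real.log (W.conductorNorm ℤ) + Real.log (((W.minimalDiscriminantNorm ℤ).factorization p * (W.minimalDiscriminantNorm ℤ).factorization q : ℕ) : ℝ)) → (∀ ε : ℝ, 0 < ε → ∃ C : ℝ, ∀ (W : WeierstrassCurve ℚ) [W.IsElliptic], (∀ p : ℕ, p.Prime → p ≠ 2 → ¬ p ^ 2 ∣ W.conductorNorm ℤ) → ∀ p ∈ (W.conductorNorm ℤ).primeFactors.filter (fun p => ¬ p ^ 2 ∣ W.conductorNorm ℤ), ∀ q ∈ (W.conductorNorm ℤ).primeFactors.filter (fun p => ¬ p ^ 2 ∣ W.conductorNorm ℤ), p ≠ q → (((W.minimalDiscriminantNorm ℤ).factorization p * (W.minimalDiscriminantNorm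 ℤ).factorization q : ℕ) : ℝ) ≤ C * (W.conductorNorm ℤ : ℝ) ^ ε) → ∀ ε : ℝ, 0 < ε → ∃ C : ℝ, ∀ (W : WeierstrassCurve ℚ) [W.IsElliptic], (∀ p : ℕ, p.Prime → p ≠ 2 → ¬ p ^ 2 ∣ W.conductorNorm ℤ) → ∀ p ∈ (W.conductorNorm ℤ).primeFactors.filter (fun p => ¬ p ^ 2 ∣ W.conductorNorm ℤ), ∀ q ∈ (W.conductorNorm ℤ).primeFactors.filter (fun p => ¬ p ^ 2 ∣ W.conductorNorm ℤ), p ≠ q → ∀ (L : PeriodPair), (∃ C' : WeierstrassCurve.VariableChange ℚ, (C' • W).IsGloballyMinimal ∧ Literature.NumberTheory.EllipticCurves.ModularForms.IsNeronLatticeOf ((C' • W).baseChange ℂ) L) → ∀ (X : Literature.NumberTheory.Automorphic.ShimuraCurveData (p * q) (W.conductorNorm ℤ / (p * q))) (F : Set UpperHalfPlane), Literature.NumberTheory.Automorphic.IsHypFundamentalDomain X.Gamma F → MeasureTheory.volume F ≠ 0 → MeasureTheory.volume F ≠ ⊤ → ∀ (s : CuspForm X.Gamma 2), s ≠ 0 →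 Literature.NumberTheory.Automorphic.HasPeriodsIn X.Gamma s (L.lattice : Set ℂ) → MeasureTheory.IntegrableOn (fun z => ‖s z‖ ^ 2 * z.im ^ 2) F → (0 < ∫ z in F, ‖s z‖ ^ 2 * z.im ^ 2) → -(ε * Real.log (W.conductorNorm ℤ) + C) ≤ Real.log ((MeasureTheory.volume F).toReal⁻¹ * ∫ z in F, ‖s z‖ ^ 2 * z.im ^ 2) := by
  intro hlow hpair ε hε
  have hε2 : 0 < ε / 2 := half_pos hε
  obtain ⟨C₁, hC₁⟩ := hlow (ε / 2) hε2
  obtain ⟨C₂, hC₂⟩ := hpair (ε / 2) hε2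
  refine ⟨C₁ + max (Real.log C₂) 0, fun W _ hss p hp q hq hpq L hL X F hFD hF0 hFt s hs0 hper hint hIpos => ?_⟩
  have h1 := hC₁ W hss p hp q hq hpq L hL X F hFD hF0 hFt s hs0 hper hint hIpos
  have h2 := hC₂ W hss p hp q hq hpq
  set N : ℝ := (W.conductorNorm ℤ : ℝ) with hNdef
  set V : ℝ := (MeasureTheory.volume F).toReal with hVdef
  set I : ℝ := ∫ z in F, ‖s z‖ ^ 2 * z.im ^ 2 with hIdef
  set m : ℕ := (W.minimalDiscriminantNorm ℤ).factorization p *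
    (W.minimalDiscriminantNorm ℤ).factorization q with hmdef
  have hN1 : 1 ≤ N := by
    rw [hNdef]; exact_mod_cast W.conductorNorm_pos_holds
  have hN0 : 0 < N := by linarith
  have hV : 0 < V := ENNReal.toReal_pos hF0 hFt
  have hm1 : 1 ≤ m := Nat.one_le_iff_ne_zero.mpr (Nat.mul_ne_zero
    (Nat.one_le_iff_ne_zero.mp (ManyPrimeValuationProduct.one_le_factorization_of_mem_filter W hp))
    (Nat.one_le_iff_ne_zero.mp (ManyPrimeValuationProduct.one_le_factorization_of_mem_filter W hq)))
  have hm0 : (0 : ℝ) < (m : ℝ) := by exact_mod_cast hm1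
  have hNε : 0 < N ^ (ε / 2) := Real.rpow_pos_of_pos hN0 _
  -- `C₂ N^{ε/2} ≥ m ≥ 1 > 0`, so `C₂ > 0`
  have hC₂N : (m : ℝ) ≤ C₂ * N ^ (ε / 2) := h2
  have hC₂pos : 0 < C₂ := by
    by_contra hle
    push Not at hle
    have : C₂ * N ^ (ε / 2) ≤ 0 := mul_nonpos_of_nonpos_of_nonneg hle hNε.le
    linarith
  have hlogm : Real.log (m : ℝ) ≤ Real.log C₂ + ε / 2 * Real.log N := by
    have h := Real.log_le_log hm0 hC₂N
    rw [Real.log_mul hC₂pos.ne' hNε.ne', Real.log_rpow hN0] at h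
    linarith
  have hlogVI : Real.log (V⁻¹ * I) = Real.log I - Real.log V := by
    rw [Real.log_mul (inv_ne_zero hV.ne') hIpos.ne', Real.log_inv]; ring
  rw [hlogVI]
  have hmax : Real.log C₂ ≤ max (Real.log C₂) 0 := le_max_left _ _
  have hsum : ε / 2 * Real.log N + ε / 2 * Real.log N = ε * Real.log N := by ring
  linarith

/-- **The lever from the LOWER package and the two valuation-product cruxes r2 ∧ r4.** [folklore] -/
theorem twoPrimeMeanSquareLowerBound_of_lowerPackage_of_manyPrime_of_fewPrime : (∀ ε : ℝ, 0 < ε → ∃ C : ℝ, ∀ (W : WeierstrassCurve ℚ) [W.IsElliptic], (∀ p : ℕ, p.Prime → p ≠ 2 → ¬ p ^ 2 ∣ W.conductorNorm ℤ) → ∀ p ∈ (W.conductorNorm ℤ).primeFactors.filter (fun p => ¬ p ^ 2 ∣ W.conductorNorm ℤ), ∀ q ∈ (W.conductorNorm ℤ).primeFactors.filter (fun p => ¬ p ^ 2 ∣ W.conductorNorm ℤ), p ≠ q → ∀ (L : PeriodPair), (∃ C' : WeierstrassCurve.VariableChange ℚ, (C' • W).IsGloballyMinimal ∧ Literature.NumberTheory.EllipticCurves.ModularForms.IsNeronLatticeOf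 ((C' • W).baseChange ℂ) L) → ∀ (X : Literature.NumberTheory.Automorphic.ShimuraCurveData (p * q) (W.conductorNorm ℤ / (p * q))) (F : Set UpperHalfPlane), Literature.NumberTheory.Automorphic.IsHypFundamentalDomain X.Gamma F → MeasureTheory.volume F ≠ 0 → MeasureTheory.volume F ≠ ⊤ → ∀ (s : CuspForm X.Gamma 2), s ≠ 0 → Literature.NumberTheory.Automorphic.HasPeriodsIn X.Gamma s (L.lattice : Set ℂ) → MeasureTheory.IntegrableOn (fun z => ‖s z‖ ^ 2 * z.im ^ 2) F → (0 < ∫ z in F, ‖s z‖ ^ 2 * z.im ^ 2) → Real.log (MeasureTheory.volume F).toReal - Real.log (∫ z in F, ‖s z‖ ^ 2 * z.im ^ 2) ≤ C + ε * Real.log (W.conductorNorm ℤ) + Real.log (((W.minimalDiscriminantNorm ℤ).factorization p * (W.minimalDiscriminantNorm ℤ).factorization q : ℕ) : ℝ)) → Summit.ABC.ABC.Theses.RibetTakahashiSplit.ManyPrimeValuationProduct → Summit.ABC.ABC.Theses.RibetTakahashiSplit.FewPrimeValuationProduct → ∀ ε : ℝ, 0 < ε → ∃ C : ℝ, ∀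 (W : WeierstrassCurve ℚ) [W.IsElliptic], (∀ p : ℕ, p.Prime → p ≠ 2 → ¬ p ^ 2 ∣ W.conductorNorm ℤ) → ∀ p ∈ (W.conductorNorm ℤ).primeFactors.filter (fun p => ¬ p ^ 2 ∣ W.conductorNorm ℤ), ∀ q ∈ (W.conductorNorm ℤ).primeFactors.filter (fun p => ¬ p ^ 2 ∣ W.conductorNorm ℤ), p ≠ q → ∀ (L : PeriodPair), (∃ C' : WeierstrassCurve.VariableChange ℚ, (C' • W).IsGloballyMinimal ∧ Literature.NumberTheory.EllipticCurves.ModularForms.IsNeronLatticeOf ((C' • W).baseChange ℂ) L) → ∀ (X : Literature.NumberTheory.Automorphic.ShimuraCurveData (p * q) (W.conductorNorm ℤ / (p * q))) (F : Set UpperHalfPlane), Literature.NumberTheory.Automorphic.IsHypFundamentalDomain X.Gamma F → MeasureTheory.volume F ≠ 0 → MeasureTheory.volume F ≠ ⊤ → ∀ (s : CuspForm X.Gamma 2), s ≠ 0 → Literature.NumberTheory.Automorphic.HasPeriodsIn X.Gamma s (L.lattice : Set ℂ) → MeasureTheory.IntegrableOn (fun z => ‖s z‖ ^ 2 * z.im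 ^ 2) F → (0 < ∫ z in F, ‖s z‖ ^ 2 * z.im ^ 2) → -(ε * Real.log (W.conductorNorm ℤ) + C) ≤ Real.log ((MeasureTheory.volume F).toReal⁻¹ * ∫ z in F, ‖s z‖ ^ 2 * z.im ^ 2) :=
  fun hlow h2 h4 => twoPrimeMeanSquareLowerBound_of_lowerPackage_of_pairBound hlow
    (twoPrime_pairBound_of_manyPrime_of_fewPrime h2 h4)

/-- **The lever from the LOWER package and Szpiro's conjecture** (so, like the crux, the lever is
irrefutable short of `¬ Szpiro`). [folklore] -/
theorem twoPrimeMeanSquareLowerBound_of_lowerPackage_of_szpiro : (∀ ε : ℝ, 0 < ε → ∃ C : ℝ, ∀ (W : WeierstrassCurve ℚ) [W.IsElliptic], (∀ p : ℕ, p.Prime → p ≠ 2 → ¬ p ^ 2 ∣ W.conductorNorm ℤ) → ∀ p ∈ (W.conductorNorm ℤ).primeFactors.filter (fun p => ¬ p ^ 2 ∣ W.conductorNorm ℤ), ∀ q ∈ (W.conductorNorm ℤ).primeFactors.filter (fun p => ¬ p ^ 2 ∣ W.conductorNorm ℤ), p ≠ q → ∀ (L : PeriodPair), (∃ C' : WeierstrassCurve.VariableChange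 ℚ, (C' • W).IsGloballyMinimal ∧ Literature.NumberTheory.EllipticCurves.ModularForms.IsNeronLatticeOf ((C' • W).baseChange ℂ) L) → ∀ (X : Literature.NumberTheory.Automorphic.ShimuraCurveData (p * q) (W.conductorNorm ℤ / (p * q))) (F : Set UpperHalfPlane), Literature.NumberTheory.Automorphic.IsHypFundamentalDomain X.Gamma F → MeasureTheory.volume F ≠ 0 → MeasureTheory.volume F ≠ ⊤ → ∀ (s : CuspForm X.Gamma 2), s ≠ 0 → Literature.NumberTheory.Automorphic.HasPeriodsIn X.Gamma s (L.lattice : Set ℂ) → MeasureTheory.IntegrableOn (fun z => ‖s z‖ ^ 2 * z.im ^ 2) F → (0 < ∫ z in F, ‖s z‖ ^ 2 * z.im ^ 2) → Real.log (MeasureTheory.volume F).toReal - Real.log (∫ z in F, ‖s z‖ ^ 2 * z.im ^ 2) ≤ C + ε * Real.log (W.conductorNorm ℤ) + Real.log (((W.minimalDiscriminantNorm ℤ).factorization p * (W.minimalDiscriminantNorm ℤ).factorization q : ℕ) : ℝ)) → Literature.NumberTheory.EllipticCurves.SzpiroConjecture → ∀ ε : ℝ, 0 < ε → ∃ C : ℝ,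 ∀ (W : WeierstrassCurve ℚ) [W.IsElliptic], (∀ p : ℕ, p.Prime → p ≠ 2 → ¬ p ^ 2 ∣ W.conductorNorm ℤ) → ∀ p ∈ (W.conductorNorm ℤ).primeFactors.filter (fun p => ¬ p ^ 2 ∣ W.conductorNorm ℤ), ∀ q ∈ (W.conductorNorm ℤ).primeFactors.filter (fun p => ¬ p ^ 2 ∣ W.conductorNorm ℤ), p ≠ q → ∀ (L : PeriodPair), (∃ C' : WeierstrassCurve.VariableChange ℚ, (C' • W).IsGloballyMinimal ∧ Literature.NumberTheory.EllipticCurves.ModularForms.IsNeronLatticeOf ((C' • W).baseChange ℂ) L) → ∀ (X : Literature.NumberTheory.Automorphic.ShimuraCurveData (p * q) (W.conductorNorm ℤ / (p * q))) (F : Set UpperHalfPlane), Literature.NumberTheory.Automorphic.IsHypFundamentalDomain X.Gamma F → MeasureTheory.volume F ≠ 0 → MeasureTheory.volume F ≠ ⊤ → ∀ (s : CuspForm X.Gamma 2), s ≠ 0 → Literature.NumberTheory.Automorphic.HasPeriodsIn X.Gamma s (L.lattice : Set ℂ) → MeasureTheory.IntegrableOn (fun z => ‖s z‖ ^ 2 *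 z.im ^ 2) F → (0 < ∫ z in F, ‖s z‖ ^ 2 * z.im ^ 2) → -(ε * Real.log (W.conductorNorm ℤ) + C) ≤ Real.log ((MeasureTheory.volume F).toReal⁻¹ * ∫ z in F, ‖s z‖ ^ 2 * z.im ^ 2) :=
  fun hlow hS => twoPrimeMeanSquareLowerBound_of_lowerPackage_of_pairBound hlow
    (twoPrime_pairBound_of_szpiro hS)

end Summit.ABC.ABC.Theorems.FewPrimeValuationProduct

end
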